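import Mathlib
import HarnessLib
import Summits.AtomisticToContinuum.FouriersLaw.Theses.StaticAbelianSqueeze
import Summits.AtomisticToContinuum.FouriersLaw.Theorems.StaticAbelianSqueezeUniformAbelianRegularityMonotoneWindow
import Summits.AtomisticToContinuum.FouriersLaw.Theorems.LatticeLandauDampingAbelThermodynamicLimitAutocorrIntegrableOn

/-!
# Glue of composition B, line `Sketch`: truncated Green–Kubo quasi-additivity ⟹ Abel-deficit quasi-additivity
(crux `StaticAbelianSqueeze.UniformAbelianRegularity` = (R), item stmt-AtomisticToContinuum-13416; `--supports` file proving the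
registered glue stub `stub_abelDeficitQuasiAdditiveOfTruncatedGK`; closes nothing)

`stub_abelDeficitQuasiAdditive` (halving quasi-additivity of the Abel deficit `S_M(ν)`, uniformly in
`ν ∈ (0, ν₁]`) follows — for EVERY `ν > 0`, same constant — from ONE `ν`-free statement (TGK3): halving
quasi-additivity of the TRUNCATED Green–Kubo integrals `G_M(ξ) = ∫_{(ξ,∞)} c_M`, uniformly in the
truncation point `ξ ≥ 0`:
  `∃ K, δ ∈ (0,1), N₁: ∀ N ≥ 2N₁, ∀ ξ ≥ 0, |G_N(ξ) − G_{⌊N/2⌋}(ξ) − G_{N−⌊N/2⌋}(ξ)| ≤ K N^{1−δ}`.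
Proof: the landed Bonnet bound `stub_monotoneWindow` (p-landed, weight `L(t) = 1 − e^{−νt}`: monotone,
continuous, `L 0 = 0`, `L ≤ 1`) applied to `d_N = c_N − c_{⌊N/2⌋} − c_{⌈N/2⌉}`, integrable on `(0,∞)` by
the landed fixed-`N` integrability `stub_autocorrIntegrableOn` (p144688).
(TGK3) is NOT in the tree: its face `ξ = 0` is, by (K) `kuboAbelIdentity_holds`, halving quasi-additivity
of `(N−1)T²D_N` with a power defect (⇒ `D_N → κ` at rate `N^{−δ}`); its face `ξ ≥ c₀N` is `stub_postCrossingTails`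
with `ε ↦ K N^{−δ}`.  It is the registered physical stub `stub_truncatedGKQuasiAdditive` of the skeleton (rev 5).
-/

noncomputable section

namespace Summit.AtomisticToContinuum.FouriersLaw.Theorems.UniformAbelianRegularity.ZeroMeanDyadicSplice

open MeasureTheory Set Filter Topology
open Summit.AtomisticToContinuum.FouriersLaw.Theorems.AbelThermodynamicLimit.SeriesLawAtEveryLaplaceFrequency
  (stub_autocorrIntegrableOn)

/-- **Registered glue stub `stub_abelDeficitQuasiAdditiveOfTruncatedGK` of line `Sketch` (crux stmt-AtomisticToContinuum-13416).**
(TGK3) — halving quasi-additivity of the TRUNCATED Green–Kubo integrals `∫_{(ξ,∞)} (c_N − c_{⌊N/2⌋} − c_{⌈N/2⌉})`, uniformly in the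
truncation point `ξ ≥ 0`, with a power defect — implies the registered stub `stub_abelDeficitQuasiAdditive` (halving quasi-additivity
of the Abel deficit, uniformly in `ν ∈ (0, ν₁]`) VERBATIM, with `ν₁ = 1` (indeed for every `ν > 0`, same constant): the landed Bonnet
bound `stub_monotoneWindow` (p149168) for the monotone continuous weight `L(t) = 1 − e^{−νt}` (`L 0 = 0`, `L ≤ 1`) against the
three-chain difference, integrable on `(0,∞)` by the landed fixed-`N` integrability `stub_autocorrIntegrableOn` (p144688).
Written by a wave-3 stub-worker of the lead (c1). [folklore] -/
theorem stub_abelDeficitQuasiAdditiveOfTruncatedGK :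
    (∀ ω₂ lam β γ : ℝ, 0 < ω₂ → 0 < lam → 0 < β → 0 < γ → ∀ T : ℝ, 0 < T → ∃ (K δ : ℝ) (N₁ : ℕ), 0 < δ ∧ δ < 1 ∧ ∀ N : ℕ, 2 * N₁ ≤ N → ∀ ξ : ℝ, 0 ≤ ξ → let c : ℕ → ℝ → ℝ := fun M t => ∫ z, (∑ i : Fin M, (Literature.MathematicalPhysics.KineticTheory.HeatConduction.pinnedChain ω₂ lam β γ).bondCurrent M i z) * (∫ y, (∑ i : Fin M, (Literature.MathematicalPhysics.KineticTheory.HeatConduction.pinnedChain ω₂ lam β γ).bondCurrent M i y) ∂((Literature.MathematicalPhysics.KineticTheory.HeatConduction.pinnedChain ω₂ lam β γ).transitionKernel M T T t.toNNReal z)) ∂((Literature.MathematicalPhysics.KineticTheory.HeatConduction.pinnedChain ω₂ lam β γ).gibbsMeasure M T); |∫ s in Set.Ioi ξ, (c N s - c (N / 2) s - c (N - N / 2) s)| ≤ K * (N:ℝ) ^ (1 - δ)) →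
    ∀ ω₂ lam β γ : ℝ, 0 < ω₂ → 0 < lam → 0 < β → 0 < γ → ∀ T : ℝ, 0 < T →
      ∃ (K δ ν₁ : ℝ) (N₁ : ℕ), 0 < δ ∧ δ < 1 ∧ 0 < ν₁ ∧ ∀ ν : ℝ, 0 < ν → ν ≤ ν₁ → ∀ N : ℕ, 2 * N₁ ≤ N →
        let c : ℕ → ℝ → ℝ := fun M t => ∫ z, (∑ i : Fin M, (Literature.MathematicalPhysics.KineticTheory.HeatConduction.pinnedChain ω₂ lam β γ).bondCurrent M i z) * (∫ y, (∑ i : Fin M, (Literature.MathematicalPhysics.KineticTheory.HeatConduction.pinnedChain ω₂ lam β γ).bondCurrent M i y) ∂((Literature.MathematicalPhysics.KineticTheory.HeatConduction.pinnedChain ω₂ lam β γ).transitionKernel M T T t.toNNReal z)) ∂((Literature.MathematicalPhysics.KineticTheory.HeatConduction.pinnedChain ω₂ lam β γ).gibbsMeasure M T);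
        let S : ℕ → ℝ := fun M => ∫ t in Set.Ioi (0:ℝ), (1 - Real.exp (-(ν * t))) * c M t;
        |S N - S (N / 2) - S (N - N / 2)| ≤ K * (N:ℝ) ^ (1 - δ) := by
  intro hTGK ω₂ lam β γ hω hl hβ hγ T hT
  obtain ⟨K, δ, N₁, hδ, hδ1, hQ⟩ := hTGK ω₂ lam β γ hω hl hβ hγ T hT
  refine ⟨K, δ, 1, N₁, hδ, hδ1, one_pos, ?_⟩
  intro ν hν _hν1 N hN c S
  -- fixed-`M` integrability of `c M` on `(0, ∞)` (landed, p144688)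
  have hint : ∀ M : ℕ, IntegrableOn (c M) (Ioi 0) := fun M =>
    stub_autocorrIntegrableOn ω₂ lam β γ hω hl hβ hγ T hT M
  -- the Abel weight `L t = 1 - e^{-ν t}`: monotone, continuous, `L 0 = 0`, `0 ≤ L ≤ 1` on `t ≥ 0`
  obtain ⟨L, hL⟩ : ∃ L : ℝ → ℝ, ∀ t, L t = 1 - Real.exp (-(ν * t)) := ⟨_, fun _ => rfl⟩
  have hLmono : Monotone L := by
    intro x y hxy
    rw [hL, hL]
    have : Real.exp (-(ν * y)) ≤ Real.exp (-(ν * x)) :=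
      Real.exp_le_exp.2 (by nlinarith [hν.le])
    linarith
  have hLcont : Continuous L := by
    have : L = fun t => 1 - Real.exp (-(ν * t)) := funext hL
    rw [this]; fun_prop
  have hL0 : L 0 = 0 := by simp [hL]
  have hL1 : ∀ t, L t ≤ 1 := fun t => by
    rw [hL]; linarith [Real.exp_pos (-(ν * t))]
  have hLnn : ∀ t, 0 ≤ t → 0 ≤ L t := fun t ht => by
    rw [hL]
    have : Real.exp (-(ν * t)) ≤ 1 := Real.exp_le_one_iff.2 (by nlinarith [hν.le])
    linarith
  -- integrability of `L · c M` on `(0, ∞)`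
  have hLint : ∀ M : ℕ, IntegrableOn (fun t => L t * c M t) (Ioi 0) := fun M => by
    refine Integrable.bdd_mul (c := 1) (hint M) hLcont.aestronglyMeasurable ?_
    filter_upwards [ae_restrict_mem measurableSet_Ioi] with t ht
    rw [Real.norm_eq_abs, abs_le]
    exact ⟨by linarith [hLnn t (le_of_lt ht)], hL1 t⟩
  -- the three-chain difference `d = c_N − c_{⌊N/2⌋} − c_{⌈N/2⌉}`
  obtain ⟨d, hd⟩ : ∃ d : ℝ → ℝ, ∀ t, d t = c N t - c (N / 2) t - c (N - N / 2) t := ⟨_, fun _ => rfl⟩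
  have hdint : IntegrableOn d (Ioi 0) := by
    have : d = fun t => c N t - c (N / 2) t - c (N - N / 2) t := funext hd
    rw [this]; exact ((hint N).sub (hint _)).sub (hint _)
  -- `S N − S ⌊N/2⌋ − S ⌈N/2⌉ = ∫_{(0,∞)} L · d`
  have hS : ∫ t in Ioi (0:ℝ), L t * d t = S N - S (N / 2) - S (N - N / 2) := by
    have h1 : (fun t => L t * d t) =
        fun t => (L t * c N t - L t * c (N / 2) t) - L t * c (N - N / 2) t := by
      funext t; rw [hd]; ring
    have h12 : IntegrableOn (fun t => L t * c N t - L t * c (N / 2) t) (Ioi 0) :=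
      (hLint N).sub (hLint _)
    rw [h1, integral_sub h12 (hLint _), integral_sub (hLint N) (hLint _)]
    simp only [hL]
    rfl
  rw [← hS]
  -- Bonnet bound for the monotone weight against the uniform signed tails of `d`
  refine stub_monotoneWindow d L 0 (K * (N:ℝ) ^ (1 - δ)) hdint hLmono hLcont hL0 hL1 ?_
  intro ξ hξ
  have hq := hQ N hN ξ hξ
  have h2 : (fun s => d s) = fun s => c N s - c (N / 2) s - c (N - N / 2) s := funext hd
  simp only [h2]
  exact hq

end Summit.AtomisticToContinuum.FouriersLaw.Theorems.UniformAbelianRegularity.ZeroMeanDyadicSplice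

end
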